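import Literature.LinearAlgebra.Matrix.ChoiTheoremCompletelyPositiveMaps
import Literature.InformationTheory.Entanglement.WernerStateSeparability
import Literature.MathematicalPhysics.QuantumLattice.KroneckerPartialTrace
import Mathlib.Analysis.Matrix.Order
import HarnessLib

/-!
# Entanglement-breaking channels are the measure-and-prepare (Holevo-form) channels (Horodecki–Shor–Ruskai 2003,
# Theorem 4 (A) ⟺ (B) ⟺ (C), (D) ⇒ (A); Watrous, Exercise 6.1)

Hodge foundations lane (`lit-hodgefound`, prover p24 gen 69 #14; matrix-analysis series, sequel of
`QuantumToClassicalChannels.lean` (#10)).  THEOREMS ONLY: no definition, no named fact, net debt 0.  Conventions of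
the tree: a linear `Φ : M_n(ℂ) → M_m(ℂ)`; its ampliation `(1_p ⊗ Φ)(X)` for `X ∈ M_{p×n}` is
`comp p p m m ℂ (((comp p p n n ℂ).symm X).map Φ)` (`ChoiTheoremCompletelyPositiveMaps.lean`, Φ acting on each
`n × n` block); the Choi matrix is `J(Φ) = comp n n m m ℂ (of fun j k => Φ (single j k 1)) = (1_n ⊗ Φ)(Σ E_jk ⊗ E_jk)`
(`choi_eq_amp`); separability of a STATE on `ℂ^p ⊗ ℂ^m` is `PPT.IsSeparable` of `WernerStateSeparability.lean`
(finite mixtures `Σ_i p_i σA_i ⊗ₖ σB_i` of products of density operators), so «`J(Φ)` separable» is stated for the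
normalized Choi state `n⁻¹ J(Φ)`.

## Source, VERBATIM — M. Horodecki, P. W. Shor, M. B. Ruskai, *Entanglement breaking channels*, Rev. Math. Phys.
**15** (2003) 629–641 [HorodeckiShorRuskai2003] (held `paper:arxiv-quant-ph_0302031`, chunks p0003, p0005)

«Such channels can be written in the form `Φ(ρ) = Σ_k R_k Tr F_k ρ` (1) where each `R_k` is a density matrix and the
`{F_k}` form a positive operator valued measure POVM. We call this the "Holevo form" … **Definition 1.** A stochastic
map `Φ` is called entanglement breaking if `(I ⊗ Φ)(Γ)` is always separable …
**Theorem 4.** The following are equivalent: A) `Φ` has the Holevo form (1) with `F_k` positive semi-definite.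
B) `Φ` is entanglement breaking. C) `(I ⊗ Φ)(|β⟩⟨β|)` is separable for `|β⟩ = d^{-1/2} Σ_j |j⟩ ⊗ |j⟩` a maximally
entangled state. D) `Φ` can be written in operator sum form using only Kraus operators of rank one. … A
corresponding equivalence holds for CPT and EBT maps with the additional conditions that `{F_k}` is a POVM …
*Proof.* To show that (A) ⇒ (B) note that when `Φ` has the form (1),
`(I ⊗ Φ)(Γ) = Σ_k R_k ⊗ T_2(√E_k Γ √E_k) = Σ_k γ_k R_k ⊗ Q_k` where `T_2` denotes the partial trace,
`γ_k = Tr E_k Γ` and `Q_k = γ_k⁻¹ T_2(√E_k Γ √E_k)`. Thus, for arbitrary `Γ`, `(I ⊗ Φ)(Γ)` is separable.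
The implication (B) ⇒ (C) is trivial. To see that (C) ⇒ (A), observe that since `(I ⊗ Φ)(|β⟩⟨β|)` is separable,
one can find … `(I ⊗ Φ)(|β⟩⟨β|) ≡ d⁻¹ Σ_{jk} |j⟩⟨k| ⊗ Φ(|j⟩⟨k|) = Σ_n p_n |v_n⟩⟨v_n| ⊗ |w_n⟩⟨w_n|`. Now let `Ω` be
the map `Ω(ρ) = d Σ_n |w_n⟩⟨w_n| Tr(ρ p_n |v̄_n⟩⟨v̄_n|)`. … Since a map `Φ` is uniquely determined by its action on
the basis `|j⟩⟨k|` … we can conclude that `Φ = Ω`. For trace-preserving maps, we also need to verify that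
`{d p_n |v̄_n⟩⟨v̄_n|}` is a POVM. Taking the partial trace … and using the fact that `Φ` is trace-preserving yields …
the desired result. … To show that (D) ⇒ (A), suppose that `Φ(ρ) = Σ_k A_k ρ A_k^†` with `A_k = |w_k⟩⟨u_k|`. Then
the map `Φ` can be written in the form (1) with `R_k = |w_k⟩⟨w_k|` …»
(Watrous, *The Theory of Quantum Information*, Exercise 6.1, states the equivalence 1 ⟺ 2 ⟺ 3 of the same three
conditions [Watrous2018].)

## Dictionary and deviations (recorded)

* The separable decomposition is taken with general density-operator factors `σA_i` (the tree's `IsSeparable`),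
  so in (C) ⇒ (A) the POVM elements are `F_i = n p_i σA_iᵀ` (the transpose is the `|v̄⟩⟨v̄|` of the source);
  in (A) ⇒ (B) the first factors are the block traces `G_k(b,c) = Tr(F_k X_{bc})` (`= T_2((1⊗√F_k)X(1⊗√F_k))`,
  positive as a partial trace), normalized.
* (D) ⇒ (A) is the algebraic identity `|w⟩⟨u| X |u⟩⟨w| = ⟨u|X|u⟩ |w⟩⟨w|` summed over the Kraus family.

## What is formalized (all PROVED)

* § 1 (A) ⇒ (B): `amp_holevoForm` (`(1 ⊗ Φ)(X) = Σ_k G_k ⊗ R_k`), `posSemidef_blockTrace`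
  (`G_k ⪰ 0`), `sum_trace_blockTrace` (`Σ_k Tr G_k = Tr X` for a POVM), **`isSeparable_amp_of_holevoForm`**.
* § 2 (B) ⇒ (C): `trace_comp_single`, **`isSeparable_choi_of_entanglementBreaking`**.
* § 3 (C) ⇒ (A): **`holevoForm_of_isSeparable_choi`** (with the POVM property under trace preservation).
* § 4 (D) ⇒ (A): `rankOne_conj_eq`, **`holevoForm_of_rankOne_kraus`**.
-/

noncomputable section

open Matrix Finset
open scoped ComplexOrder MatrixOrder Kronecker

namespace Literature.InformationTheory.Entanglement.EntanglementBreakingChannels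

open Literature.InformationTheory.Entanglement.PPT (IsSeparable)
open Literature.Computability.QuantumComplexity (traceRight traceRight_apply)
open Literature.MathematicalPhysics.QuantumLattice (posSemidef_traceRight)
open Literature.LinearAlgebra.Matrix.ChoiTheoremCompletelyPositiveMaps (amp_apply choi_eq_amp posSemidef_comp_single
  eq_of_apply_single_eq)

variable {n m p : Type*} [Fintype n] [DecidableEq n] [Fintype m] [DecidableEq m] [Fintype p] [DecidableEq p]
variable {ι : Type} [Fintype ι]

/-! ## § 1 (A) ⇒ (B): Holevo-form channels break entanglement -/

section AtoB

omit [DecidableEq n] [Fintype m] [DecidableEq m] [Fintype p] [DecidableEq p] in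
/-- `(1_p ⊗ Φ)(X) = Σ_k G_k ⊗ R_k` with the block traces `G_k(b,c) = Tr(F_k X_{bc})` when
`Φ(X) = Σ_k Tr(F_k X) R_k`. [cite: HorodeckiShorRuskai2003, Theorem 4 ((A) ⇒ (B))] -/
theorem amp_holevoForm (Φ : Matrix n n ℂ →ₗ[ℂ] Matrix m m ℂ) (F : ι → Matrix n n ℂ) (R : ι → Matrix m m ℂ)
    (hΦ : ∀ X, Φ X = ∑ a, (F a * X).trace • R a) (X : Matrix (p × n) (p × n) ℂ) :
    comp p p m m ℂ (((comp p p n n ℂ).symm X).map Φ) =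
      ∑ a, (of fun b c => (F a * of fun i j => X (b, i) (c, j)).trace) ⊗ₖ R a := by
  ext ⟨b, i'⟩ ⟨c, j'⟩
  change Φ (of fun i j => X (b, i) (c, j)) i' j' = _
  rw [hΦ, Matrix.sum_apply, Matrix.sum_apply]
  refine Finset.sum_congr rfl fun a _ => ?_
  rw [Matrix.smul_apply, kroneckerMap_apply, of_apply, smul_eq_mul]

omit [DecidableEq n] in
/-- The `(b,c)` block of `(1 ⊗ S) X (1 ⊗ S)^*` is `S X_{bc} S^*`. [folklore] -/
private theorem blockConj_apply (S : Matrix n n ℂ) (X : Matrix (p × n) (p × n) ℂ) (b c : p) (i j : n) :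
    ((1 : Matrix p p ℂ) ⊗ₖ S * X * ((1 : Matrix p p ℂ) ⊗ₖ S)ᴴ) (b, i) (c, j) =
      (S * of (fun i j => X (b, i) (c, j)) * Sᴴ) i j := by
  rw [conjTranspose_kronecker, conjTranspose_one]
  simp only [Matrix.mul_apply, Fintype.sum_prod_type, kroneckerMap_apply, one_apply, of_apply, conjTranspose_apply,
    ite_mul, one_mul, zero_mul, mul_ite, mul_zero, Finset.sum_ite_irrel, Finset.sum_const_zero, Finset.sum_ite_eq,
    Finset.sum_ite_eq', Finset.mem_univ, if_true]

/-- The block trace `G(b,c) = Tr(F X_{bc})` of a positive semidefinite `X` against `F ⪰ 0` is positive semidefinite: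
it is the partial trace `T_2((1 ⊗ √F) X (1 ⊗ √F))`. [cite: HorodeckiShorRuskai2003, Theorem 4 ((A) ⇒ (B):
«`Q_k = γ_k⁻¹ T_2(√E_k Γ √E_k)`»)] -/
theorem posSemidef_blockTrace {F : Matrix n n ℂ} (hF : F.PosSemidef) {X : Matrix (p × n) (p × n) ℂ}
    (hX : X.PosSemidef) : (of fun b c => (F * of fun i j => X (b, i) (c, j)).trace : Matrix p p ℂ).PosSemidef := by
  set S : Matrix n n ℂ := CFC.sqrt F with hS
  have hSS : Sᴴ * S = F := by
    rw [hS, (CFC.sqrt_nonneg F).posSemidef.isHermitian.eq]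
    exact CFC.sqrt_mul_sqrt_self F hF.nonneg
  have hZ : ((1 : Matrix p p ℂ) ⊗ₖ S * X * ((1 : Matrix p p ℂ) ⊗ₖ S)ᴴ).PosSemidef :=
    hX.mul_mul_conjTranspose_same _
  have hG : (of fun b c => (F * of fun i j => X (b, i) (c, j)).trace : Matrix p p ℂ) =
      traceRight ((1 : Matrix p p ℂ) ⊗ₖ S * X * ((1 : Matrix p p ℂ) ⊗ₖ S)ᴴ) := by
    ext b c
    rw [of_apply, traceRight_apply, ← hSS, Matrix.mul_assoc, trace_mul_comm]
    simp only [trace, Matrix.diag_apply, blockConj_apply]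
  rw [hG]
  exact posSemidef_traceRight hZ

omit [DecidableEq p] in
/-- `Σ_k Tr G_k = Tr X` when `Σ_k F_k = 1`. [cite: HorodeckiShorRuskai2003, Theorem 4 ((A) ⇒ (B): «`γ_k = Tr E_k Γ`»)] -/
theorem sum_trace_blockTrace (F : ι → Matrix n n ℂ) (hFsum : ∑ a, F a = 1) (X : Matrix (p × n) (p × n) ℂ) :
    ∑ a, (of fun b c => (F a * of fun i j => X (b, i) (c, j)).trace : Matrix p p ℂ).trace = X.trace := by
  have h : ∀ b : p, ∑ a, (F a * of fun i j => X (b, i) (b, j)).trace = (of fun i j => X (b, i) (b, j)).trace := by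
    intro b
    rw [← trace_sum, ← Finset.sum_mul, hFsum, Matrix.one_mul]
  simp only [trace, Matrix.diag_apply, of_apply]
  rw [Finset.sum_comm, Fintype.sum_prod_type]
  exact Finset.sum_congr rfl fun b _ => h b

omit [DecidableEq m] in
/-- **Theorem 4, (A) ⇒ (B)**: a Holevo-form map `Φ(X) = Σ_k Tr(F_k X) R_k` (`F_k ⪰ 0`, `Σ F_k = 1`, `R_k` density
operators) is entanglement breaking — `(1_p ⊗ Φ)(X)` is separable for every density operator `X` on `ℂ^p ⊗ ℂⁿ`.
[cite: HorodeckiShorRuskai2003, Theorem 4 ((A) ⇒ (B))] [cite: Watrous2018, Exercise 6.1 (3 ⇒ 1)] -/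
theorem isSeparable_amp_of_holevoForm (Φ : Matrix n n ℂ →ₗ[ℂ] Matrix m m ℂ) (F : ι → Matrix n n ℂ)
    (R : ι → Matrix m m ℂ) (hF : ∀ a, (F a).PosSemidef) (hFsum : ∑ a, F a = 1)
    (hR : ∀ a, (R a).PosSemidef ∧ (R a).trace = 1) (hΦ : ∀ X, Φ X = ∑ a, (F a * X).trace • R a)
    {X : Matrix (p × n) (p × n) ℂ} (hX : X.PosSemidef) (hX1 : X.trace = 1) :
    IsSeparable (comp p p m m ℂ (((comp p p n n ℂ).symm X).map Φ)) := by
  classical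
  -- `p` is nonempty since `Tr X = 1`
  have hp : Nonempty p := by
    by_contra h
    rw [not_nonempty_iff] at h
    have : X.trace = 0 := by simp [trace]
    rw [this] at hX1
    exact zero_ne_one hX1
  have hcard : (Fintype.card p : ℂ) ≠ 0 := Nat.cast_ne_zero.mpr Fintype.card_ne_zero
  -- the block traces `G a`
  set G : ι → Matrix p p ℂ := fun a => of fun b c => (F a * of fun i j => X (b, i) (c, j)).trace with hGdef
  have hG : ∀ a, (G a).PosSemidef := fun a => posSemidef_blockTrace (hF a) hX
  have hGsum : ∑ a, (G a).trace = 1 := by rw [hGdef]; exact (sum_trace_blockTrace F hFsum X).trans hX1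
  have hGre : ∀ a, (G a).trace = (((G a).trace.re : ℝ) : ℂ) := fun a => by
    obtain ⟨-, him⟩ := Complex.nonneg_iff.mp (hG a).trace_nonneg
    exact Complex.ext (by simp) (by simp [← him])
  -- a default density operator
  set σ₀ : Matrix p p ℂ := ((Fintype.card p : ℂ))⁻¹ • (1 : Matrix p p ℂ) with hσ₀
  have hσ₀ok : σ₀.PosSemidef ∧ σ₀.trace = 1 := by
    refine ⟨PosSemidef.one.smul ?_, ?_⟩
    · rw [show ((Fintype.card p : ℂ))⁻¹ = (((Fintype.card p : ℝ)⁻¹ : ℝ) : ℂ) by push_cast; rfl]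
      exact Complex.zero_le_real.mpr (by positivity)
    · rw [trace_smul, trace_one, smul_eq_mul, inv_mul_cancel₀ hcard]
  rw [amp_holevoForm Φ F R hΦ X]
  refine ⟨ι, inferInstance, fun a => (G a).trace.re,
    fun a => if (G a).trace = 0 then σ₀ else ((G a).trace)⁻¹ • G a, R, fun a => ?_, ?_, fun a => ?_, hR, ?_⟩
  · exact (Complex.nonneg_iff.mp (hG a).trace_nonneg).1
  · have h := congrArg Complex.re hGsum
    rw [Complex.re_sum, Complex.one_re] at h
    exact h
  · dsimp only
    by_cases h0 : (G a).trace = 0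
    · rw [if_pos h0]; exact hσ₀ok
    · rw [if_neg h0]
      refine ⟨?_, by rw [trace_smul, smul_eq_mul, inv_mul_cancel₀ h0]⟩
      have hre : 0 ≤ (G a).trace.re := (Complex.nonneg_iff.mp (hG a).trace_nonneg).1
      rw [hGre a, ← Complex.ofReal_inv]
      exact (hG a).smul (Complex.zero_le_real.mpr (inv_nonneg.mpr hre))
  · refine Finset.sum_congr rfl fun a _ => ?_
    change G a ⊗ₖ R a = ((G a).trace.re : ℂ) • ((if (G a).trace = 0 then σ₀ else ((G a).trace)⁻¹ • G a) ⊗ₖ R a)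
    by_cases h0 : (G a).trace = 0
    · have hGa : G a = 0 := (hG a).trace_eq_zero_iff.mp h0
      rw [if_pos h0, show ((G a).trace.re : ℂ) = 0 by rw [h0, Complex.zero_re, Complex.ofReal_zero], zero_smul, hGa,
        zero_kronecker]
    · rw [if_neg h0, ← hGre a, smul_kronecker, smul_smul, mul_inv_cancel₀ h0, one_smul]

end AtoB

/-! ## § 2 (B) ⇒ (C): apply to the maximally entangled state -/

section BtoC

omit [Fintype n] [DecidableEq n] [Fintype m] [DecidableEq m] [Fintype p] [DecidableEq p] in
/-- The ampliation is homogeneous: `(1 ⊗ Φ)(cX) = c (1 ⊗ Φ)(X)`. [folklore] -/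
private theorem amp_smul (Φ : Matrix n n ℂ →ₗ[ℂ] Matrix m m ℂ) (c : ℂ) (X : Matrix (p × n) (p × n) ℂ) :
    comp p p m m ℂ (((comp p p n n ℂ).symm (c • X)).map Φ) = c • comp p p m m ℂ (((comp p p n n ℂ).symm X).map Φ) := by
  ext ⟨b, i'⟩ ⟨c', j'⟩
  change Φ (of fun i j => (c • X) (b, i) (c', j)) i' j' = c * Φ (of fun i j => X (b, i) (c', j)) i' j'
  rw [show (of fun i j => (c • X) (b, i) (c', j)) = c • of fun i j => X (b, i) (c', j) from rfl, map_smul,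
    Matrix.smul_apply, smul_eq_mul]

omit [Fintype m] [DecidableEq m] [Fintype p] [DecidableEq p] in
/-- `Tr(Σ_{jk} E_jk ⊗ E_jk) = n` (the unnormalized maximally entangled state). [cite: HorodeckiShorRuskai2003,
Theorem 4 ((C): «`|β⟩ = d^{-1/2} Σ_j |j⟩ ⊗ |j⟩`»)] -/
theorem trace_comp_single : (comp n n n n ℂ (of fun j k => single j k (1 : ℂ))).trace = Fintype.card n := by
  simp only [trace, Matrix.diag_apply, Fintype.sum_prod_type, comp_apply, of_apply, single_apply, and_self,
    Finset.sum_ite_eq, Finset.mem_univ, if_true, Finset.sum_const, Finset.card_univ, nsmul_eq_mul, mul_one]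

omit [DecidableEq m] in
/-- **Theorem 4, (B) ⇒ (C)**: an entanglement-breaking `Φ` has a separable normalized Choi state
`n⁻¹ J(Φ) = (1_n ⊗ Φ)(|β⟩⟨β|)`. [cite: HorodeckiShorRuskai2003, Theorem 4 ((B) ⇒ (C))]
[cite: Watrous2018, Exercise 6.1 (1 ⇒ 2)] -/
theorem isSeparable_choi_of_entanglementBreaking [Nonempty n] (Φ : Matrix n n ℂ →ₗ[ℂ] Matrix m m ℂ)
    (hEB : ∀ X : Matrix (n × n) (n × n) ℂ, X.PosSemidef → X.trace = 1 →
      IsSeparable (comp n n m m ℂ (((comp n n n n ℂ).symm X).map Φ))) :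
    IsSeparable (((Fintype.card n : ℂ))⁻¹ • comp n n m m ℂ (of fun j k => Φ (single j k 1))) := by
  have hcard : (Fintype.card n : ℂ) ≠ 0 := Nat.cast_ne_zero.mpr Fintype.card_ne_zero
  have h := hEB (((Fintype.card n : ℂ))⁻¹ • comp n n n n ℂ (of fun j k => single j k (1 : ℂ))) ?_ ?_
  · rwa [amp_smul, ← choi_eq_amp] at h
  · rw [show ((Fintype.card n : ℂ))⁻¹ = (((Fintype.card n : ℝ)⁻¹ : ℝ) : ℂ) by push_cast; rfl]
    exact posSemidef_comp_single.smul (Complex.zero_le_real.mpr (by positivity))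
  · rw [trace_smul, trace_comp_single, smul_eq_mul, inv_mul_cancel₀ hcard]

end BtoC

/-! ## § 3 (C) ⇒ (A): a separable Choi state gives the Holevo form -/

section CtoA

omit [DecidableEq m] in
/-- **Theorem 4, (C) ⇒ (A)**: if the normalized Choi state `n⁻¹ J(Φ)` is separable, `n⁻¹ J(Φ) = Σ_i p_i σA_i ⊗ σB_i`,
then `Φ(X) = Σ_i Tr(F_i X) R_i` with `F_i = n p_i σA_iᵀ ⪰ 0` and the density operators `R_i = σB_i`; if `Φ`
preserves traces then `Σ_i F_i = 1` (a POVM). [cite: HorodeckiShorRuskai2003, Theorem 4 ((C) ⇒ (A))]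
[cite: Watrous2018, Exercise 6.1 (2 ⇒ 3)] -/
theorem holevoForm_of_isSeparable_choi [Nonempty n] (Φ : Matrix n n ℂ →ₗ[ℂ] Matrix m m ℂ)
    (hsep : IsSeparable (((Fintype.card n : ℂ))⁻¹ • comp n n m m ℂ (of fun j k => Φ (single j k 1)))) :
    ∃ (κ : Type) (_ : Fintype κ) (F : κ → Matrix n n ℂ) (R : κ → Matrix m m ℂ),
      (∀ i, (F i).PosSemidef) ∧ (∀ i, (R i).PosSemidef ∧ (R i).trace = 1) ∧
      (∀ X, Φ X = ∑ i, (F i * X).trace • R i) ∧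
      ((∀ X, (Φ X).trace = X.trace) → ∑ i, F i = 1) := by
  obtain ⟨κ, _, q, σA, σB, hq, -, hA, hB, hJ⟩ := hsep
  set c : ℂ := (Fintype.card n : ℂ) with hc
  have hcard : c ≠ 0 := Nat.cast_ne_zero.mpr Fintype.card_ne_zero
  -- entries of the Choi matrix
  have hentry : ∀ (j k : n) (a b : m), Φ (single j k 1) a b = c * ∑ i, (q i : ℂ) * (σA i j k * σB i a b) := by
    intro j k a b
    have h := congrFun (congrFun hJ (j, a)) (k, b)
    rw [Matrix.smul_apply, Matrix.sum_apply] at h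
    change c⁻¹ • Φ (single j k 1) a b = _ at h
    rw [smul_eq_mul] at h
    have h' : Φ (single j k 1) a b = c * (c⁻¹ * Φ (single j k 1) a b) := by
      rw [← mul_assoc, mul_inv_cancel₀ hcard, one_mul]
    rw [h', h, Finset.mul_sum, Finset.mul_sum]
    refine Finset.sum_congr rfl fun i _ => ?_
    rw [Matrix.smul_apply, kroneckerMap_apply, smul_eq_mul]
  refine ⟨κ, inferInstance, fun i => (c * (q i : ℂ)) • (σA i)ᵀ, σB, fun i => ?_, hB, ?_, fun htp => ?_⟩
  · -- `F_i ⪰ 0`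
    refine (hA i).1.transpose.smul ?_
    rw [hc, show (Fintype.card n : ℂ) * (q i : ℂ) = (((Fintype.card n : ℝ) * q i : ℝ) : ℂ) by push_cast; rfl]
    exact Complex.zero_le_real.mpr (mul_nonneg (by positivity) (hq i))
  · -- the Holevo form, checked on matrix units
    intro X
    let Ψ : Matrix n n ℂ →ₗ[ℂ] Matrix m m ℂ :=
      { toFun := fun X => ∑ i, ((c * (q i : ℂ)) • (σA i)ᵀ * X).trace • σB i
        map_add' := fun X Y => by
          simp only [Matrix.mul_add, trace_add, add_smul, Finset.sum_add_distrib]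
        map_smul' := fun r X => by
          simp only [Matrix.mul_smul, trace_smul, smul_eq_mul, RingHom.id_apply, Finset.smul_sum, smul_smul] }
    have hΦΨ : Φ = Ψ := by
      refine eq_of_apply_single_eq Φ Ψ fun j k => ?_
      ext a b
      rw [hentry]
      change _ = (∑ i, ((c * (q i : ℂ)) • (σA i)ᵀ * single j k (1 : ℂ)).trace • σB i) a b
      rw [Matrix.sum_apply, Finset.mul_sum]
      refine Finset.sum_congr rfl fun i _ => ?_
      rw [Matrix.smul_apply, trace_mul_single, MulOpposite.op_one, one_smul, Matrix.smul_apply, transpose_apply,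
        smul_eq_mul, smul_eq_mul]
      ring
    exact congrFun (congrArg DFunLike.coe hΦΨ) X
  · -- POVM under trace preservation: `Tr Φ(E_jk) = c Σ_i q_i σA_i(j,k) = δ_jk`
    ext k j
    have h := htp (single j k 1)
    have htr : (Φ (single j k 1)).trace = c * ∑ i, (q i : ℂ) * σA i j k := by
      simp only [trace, Matrix.diag_apply, hentry]
      rw [← Finset.mul_sum, Finset.sum_comm]
      congr 1
      refine Finset.sum_congr rfl fun i _ => ?_
      have hBi : ∑ a, σB i a a = 1 := by
        have h := (hB i).2
        simpa only [trace, Matrix.diag_apply] using h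
      rw [← Finset.mul_sum, ← Finset.mul_sum, hBi, mul_one]
    rw [htr] at h
    rw [Matrix.sum_apply]
    simp only [Matrix.smul_apply, transpose_apply, smul_eq_mul]
    rw [show ∑ i, c * (q i : ℂ) * σA i j k = c * ∑ i, (q i : ℂ) * σA i j k by
      rw [Finset.mul_sum]; exact Finset.sum_congr rfl fun i _ => mul_assoc _ _ _, h, one_apply]
    by_cases hjk : j = k
    · subst hjk
      rw [trace_single_eq_same, if_pos rfl]
    · rw [trace_single_eq_of_ne j k 1 hjk, if_neg (Ne.symm hjk)]

end CtoA

/-! ## § 4 (D) ⇒ (A): rank-one Kraus operators give the Holevo form -/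

section DtoA

omit [DecidableEq n] [Fintype m] [DecidableEq m] in
/-- `|w⟩⟨u| X |u⟩⟨w| = ⟨u|X|u⟩ |w⟩⟨w|`, and `⟨u|X|u⟩ = Tr(|u⟩⟨u| X)`. [cite: HorodeckiShorRuskai2003, Theorem 4 ((D) ⇒ (A))] -/
theorem rankOne_conj_eq (w : m → ℂ) (u : n → ℂ) (X : Matrix n n ℂ) :
    vecMulVec w (star u) * X * (vecMulVec w (star u))ᴴ = (vecMulVec u (star u) * X).trace • vecMulVec w (star w) := by
  rw [conjTranspose_vecMulVec, star_star, vecMulVec_mul, vecMulVec_mul_vecMulVec, vecMulVec_mul, trace_vecMulVec,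
    dotProduct_comm]
  ext i j
  simp [vecMulVec_apply, mul_left_comm]

omit [DecidableEq n] [Fintype m] [DecidableEq m] in
/-- **Theorem 4, (D) ⇒ (A)**: a map with rank-one Kraus operators `A_k = |w_k⟩⟨u_k|` has the Holevo form with
`F_k = |u_k⟩⟨u_k|` and `R_k = |w_k⟩⟨w_k|`. [cite: HorodeckiShorRuskai2003, Theorem 4 ((D) ⇒ (A))] -/
theorem holevoForm_of_rankOne_kraus (w : ι → m → ℂ) (u : ι → n → ℂ) (X : Matrix n n ℂ) :
    ∑ k, vecMulVec (w k) (star (u k)) * X * (vecMulVec (w k) (star (u k)))ᴴ =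
      ∑ k, (vecMulVec (u k) (star (u k)) * X).trace • vecMulVec (w k) (star (w k)) :=
  Finset.sum_congr rfl fun k _ => rankOne_conj_eq (w k) (u k) X

end DtoA

end Literature.InformationTheory.Entanglement.EntanglementBreakingChannels
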